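import Summits.KontsevichZagierPeriods.KontsevichZagierPeriods.Theses.SymplecticScissors
import Literature.NumberTheory.Transcendental.AyoubPeriodSeries
import Literature.NumberTheory.Transcendental.AyoubPeriodSeriesKernel
import Literature.NumberTheory.Transcendental.AyoubPeriodSeriesLocalizing
import Literature.NumberTheory.Transcendental.AyoubPeriodSeriesProofs
import Summits.KontsevichZagierPeriods.KontsevichZagierPeriods.Theorems.SymplecticScissorsTypeAGenerationStubExactDlogAux
import Mathlib.RingTheory.MvPowerSeries.Substitution
import Mathlib.RingTheory.MvPowerSeries.Order

/-!
# `TypeAGeneration` (stmt-KontsevichZagierPeriods-18392), line `Sketch`, stub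
`stub_covSubstAnalytic` (V0): auxiliary file — substituting a one-variable series into `zᵢ ↦ G`

Auxiliary file of the registered stub `stub_covSubstAnalytic` (Ayoub's change of variables in
dimension one, `…StubCovSubstAnalytic.lean`) of the crux `TypeAGeneration` (route
SymplecticScissors, line `Sketch`), on top of
`Literature/NumberTheory/Transcendental/AyoubPeriodSeries.lean` (`AyoubRel.CSeries = ℂ[[z₀, z₁, …]]`,
`AyoubRel.UsesVar`), Mathlib's substitution API
(`MvPowerSeries.subst`, `MvPowerSeries.HasSubst`, `MvPowerSeries.coeff_subst`) and the weighted `ℓ¹`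
bookkeeping of the sibling stub files (`stub_weightedNormMul` (U0): `N_ρ(F G) ≤ N_ρ(F) N_ρ(G)`;
`u1_pow_hasSum`: `N_ρ(ψ^m) ≤ N_ρ(ψ)^m`; `d1_hasSum_norm_smul`).

For `G ∈ ℂ[[z]]` with `G(0) = 0` and a one-variable series `f = Σ_n f_n zᵢⁿ`, the family
`a = (G; z_l for l ≠ i)` and the substitution `f(G) = MvPowerSeries.subst a f`:

* `v0_hasSubst`: `a` is substitutable;
* `v0_coeff_subst`: **coefficient formula** `f(G)_e = Σ_{n < M} f_n (Gⁿ)_e` for any `M > |e|`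
  (only the axis `d = n eᵢ` contributes to `MvPowerSeries.coeff_subst`, and `(Gⁿ)_e = 0` for
  `n > |e|` as `ord Gⁿ ≥ n`); hence `f(G)` involves only variables of `G` (`v0_usesVar_subst`) and
  the coefficients of the tails `f(G) − Σ_{n<N} f_n Gⁿ` (`v0_coeff_tail`);
* `v0_dominated`: if `‖F_e‖ ≤ Σ_{n ∈ s_e} ‖(Φ_n)_e‖` (finite sets `s_e`) and `Σ_n N_w(Φ_n) < ∞` then
  `N_w(F) ≤ Σ_n N_w(Φ_n)` (Tonelli on the non-negative double family `(n, e) ↦ ‖(Φ_n)_e‖ w_e`);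
  with `Φ_n = f_{n+N} G^{n+N}` and `N_ρ(G) ≤ q`: `N_ρ(f(G) − Σ_{n<N} f_n Gⁿ) ≤ Σ_{m} |f_{m+N}| q^{m+N}`
  (`v0_subst_weights`; `N = 0` gives `N_ρ(f(G)) ≤ Σ_n |f_n| qⁿ`);
* the registered auxiliary stub `stub_covSubstAnalyticAux` packaging these four facts.

Elementary (folklore); no definition is introduced.
-/

noncomputable section

-- `Summit.KontsevichZagierPeriods.KontsevichZagierPeriods.…` is the tree's mandated layout (single-conjunct summit).
set_option linter.dupNamespace false

namespace Summit.KontsevichZagierPeriods.KontsevichZagierPeriods.TypeAGenerationLine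

open Finsupp MvPowerSeries
open Literature.NumberTheory.Transcendental
open Literature.NumberTheory.Transcendental.AyoubRel

/-! ## The substitution `zᵢ ↦ G`, `G(0) = 0`, of a one-variable series -/

/-- The family `(G; z_l for l ≠ i)` with `G(0) = 0` is substitutable. [folklore] -/
theorem v0_hasSubst (i : ℕ) {G : CSeries} (hG : constantCoeff G = 0) :
    HasSubst (fun l : ℕ => if l = i then G else (X l : CSeries)) := by
  classical
  refine ⟨fun l => ?_, fun d => ?_⟩
  · have h0 : constantCoeff (if l = i then G else (X l : CSeries)) = 0 := by
      split_ifs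
      · exact hG
      · exact constantCoeff_X l
    show IsNilpotent (constantCoeff (if l = i then G else (X l : CSeries)))
    rw [h0]
    exact IsNilpotent.zero
  · refine (d.support.finite_toSet.union (Set.finite_singleton i)).subset fun l hl => ?_
    simp only [Set.mem_setOf_eq] at hl
    by_cases hli : l = i
    · exact Or.inr hli
    · left
      rw [if_neg hli, coeff_X] at hl
      split_ifs at hl with hd
      · rw [Finset.mem_coe, hd, mem_support_iff, single_eq_same]
        exact one_ne_zero
      · exact absurd rfl hl

/-- `∏_s (a s)^{(n eᵢ) s} = Gⁿ` for the family `a = (G; z_l)`. [folklore] -/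
theorem v0_prod_single (i : ℕ) (G : CSeries) (n : ℕ) :
    ((single i n).prod fun s m => (if s = i then G else (X s : CSeries)) ^ m) = G ^ n := by
  rw [Finsupp.prod_single_index, if_pos rfl]
  exact pow_zero _

/-- `(Gⁿ)_a = 0` for `|a| < n` when `G(0) = 0` (`ord Gⁿ ≥ n`). [folklore] -/
theorem v0_coeff_pow_eq_zero {G : CSeries} (hG : constantCoeff G = 0) {a : ℕ →₀ ℕ} {n : ℕ}
    (h : degree a < n) : coeff a (G ^ n) = 0 :=
  coeff_of_lt_order (lt_of_lt_of_le (by exact_mod_cast h)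
    (le_order_pow_of_constantCoeff_eq_zero n hG))

/-- A one-variable series (variable `zᵢ`) is supported on the axis `d = dᵢ eᵢ`. [folklore] -/
theorem v0_eq_single {f : CSeries} {i : ℕ} (hf : ∀ l : ℕ, UsesVar f l → l = i) {d : ℕ →₀ ℕ}
    (hd : coeff d f ≠ 0) : d = single i (d i) := by
  ext l
  by_cases hl : l = i
  · rw [hl, single_eq_same]
  · rw [single_eq_of_ne hl]
    by_contra hne
    exact hl (hf l ⟨d, hne, hd⟩)

/-- **Coefficient formula**: `f(G)_a = Σ_{n < M} f_n (Gⁿ)_a` for any `M > |a|`, `f` one-variable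
in `zᵢ`, `G(0) = 0`. [folklore] -/
theorem v0_coeff_subst {f : CSeries} {i : ℕ} (hf : ∀ l : ℕ, UsesVar f l → l = i) {G : CSeries}
    (hG : constantCoeff G = 0) (a : ℕ →₀ ℕ) {M : ℕ} (hM : degree a < M) :
    coeff a (subst (fun l : ℕ => if l = i then G else (X l : CSeries)) f) =
      ∑ n ∈ Finset.range M, coeff (single i n) f * coeff a (G ^ n) := by
  classical
  rw [coeff_subst (v0_hasSubst i hG),
    finsum_eq_sum_of_support_subset _ (s := (Finset.range M).image (single i)) ?_]
  · rw [Finset.sum_image fun x _ y _ h => single_injective i h]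
    exact Finset.sum_congr rfl fun n _ => by rw [v0_prod_single, smul_eq_mul]
  · intro d hd
    rw [Function.mem_support] at hd
    have hd1 : coeff d f ≠ 0 := fun h => hd (by rw [h, zero_smul])
    have hd2 := v0_eq_single hf hd1
    rw [Finset.coe_image]
    refine ⟨d i, ?_, hd2.symm⟩
    rw [Finset.mem_coe, Finset.mem_range]
    by_contra hlt
    apply hd
    rw [hd2, v0_prod_single, v0_coeff_pow_eq_zero hG (lt_of_lt_of_le hM (not_lt.mp hlt)),
      smul_zero]

/-- **Variables of `f(G)`** are among the variables of `G`. [folklore] -/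
theorem v0_usesVar_subst {f : CSeries} {i : ℕ} (hf : ∀ l : ℕ, UsesVar f l → l = i) {G : CSeries}
    (hG : constantCoeff G = 0) {l : ℕ}
    (h : UsesVar (subst (fun l : ℕ => if l = i then G else (X l : CSeries)) f) l) : UsesVar G l := by
  by_contra hno
  obtain ⟨a, hal, hne⟩ := h
  apply hne
  rw [v0_coeff_subst hf hG a (Nat.lt_succ_self _)]
  refine Finset.sum_eq_zero fun n _ => ?_
  have h0 : coeff a (G ^ n) = 0 := by
    by_contra hn
    exact u1_not_usesVar_pow hno n ⟨a, hal, hn⟩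
  rw [h0, mul_zero]

/-- **Coefficients of the tail** `f(G) − Σ_{n<N} f_n Gⁿ`: `Σ_{k ≤ |a|} f_{k+N} (G^{k+N})_a`.
[folklore] -/
theorem v0_coeff_tail {f : CSeries} {i : ℕ} (hf : ∀ l : ℕ, UsesVar f l → l = i) {G : CSeries}
    (hG : constantCoeff G = 0) (a : ℕ →₀ ℕ) (N : ℕ) :
    coeff a (subst (fun l : ℕ => if l = i then G else (X l : CSeries)) f -
        ∑ n ∈ Finset.range N, coeff (single i n) f • G ^ n) =
      ∑ k ∈ Finset.range (degree a + 1), coeff (single i (k + N)) f * coeff a (G ^ (k + N)) := by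
  rw [map_sub, map_sum, v0_coeff_subst hf hG a (M := N + (degree a + 1)) (by omega),
    Finset.sum_range_add]
  simp only [coeff_smul, add_sub_cancel_left]
  exact Finset.sum_congr rfl fun k _ => by rw [add_comm]

/-! ## Weighted `ℓ¹` bounds -/

/-- **Domination**: if `‖F_a‖ ≤ Σ_{n ∈ s_a} ‖(Φ_n)_a‖` for finite sets `s_a` and
`Σ_n N_w(Φ_n) ≤ Σ_n B_n < ∞`, then `N_w(F) ≤ Σ_n B_n` (Tonelli on the non-negative double family
`(n, a) ↦ ‖(Φ_n)_a‖ w_a`, whose `a`-fibre sums dominate `‖F_a‖ w_a`). [folklore] -/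
theorem v0_dominated {w : (ℕ →₀ ℕ) → ℝ} (hw : ∀ a, 0 ≤ w a) {Φ : ℕ → CSeries} {B : ℕ → ℝ}
    (hΦ : ∀ n, ∃ D : ℝ, D ≤ B n ∧ HasSum (fun a : ℕ →₀ ℕ => ‖coeff a (Φ n)‖ * w a) D)
    (hB : Summable B) {F : CSeries}
    (hF : ∀ a : ℕ →₀ ℕ, ∃ s : Finset ℕ, ‖coeff a F‖ ≤ ∑ n ∈ s, ‖coeff a (Φ n)‖) :
    ∃ E : ℝ, E ≤ ∑' n, B n ∧ HasSum (fun a : ℕ →₀ ℕ => ‖coeff a F‖ * w a) E := by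
  set N : ℕ → ℝ := fun n => ∑' a : ℕ →₀ ℕ, ‖coeff a (Φ n)‖ * w a with hN
  have hNs : ∀ n, HasSum (fun a : ℕ →₀ ℕ => ‖coeff a (Φ n)‖ * w a) (N n) := fun n => by
    obtain ⟨D, -, hD⟩ := hΦ n
    exact hD.summable.hasSum
  have hNle : ∀ n, N n ≤ B n := fun n => by
    obtain ⟨D, hDB, hD⟩ := hΦ n
    rwa [← hD.tsum_eq] at hDB
  have hN0 : ∀ n, 0 ≤ N n := fun n => tsum_nonneg fun a => mul_nonneg (norm_nonneg _) (hw a)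
  set T : ℕ × (ℕ →₀ ℕ) → ℝ := fun p => ‖coeff p.2 (Φ p.1)‖ * w p.2 with hT
  have hT0 : 0 ≤ T := fun p => mul_nonneg (norm_nonneg _) (hw p.2)
  have hTs : Summable T :=
    (summable_prod_of_nonneg hT0).2 ⟨fun n => (hNs n).summable, Summable.of_nonneg_of_le hN0 hNle hB⟩
  have hNT : HasSum N (∑' p, T p) := hTs.hasSum.prod_fiberwise hNs
  have htot : ∑' p, T p ≤ ∑' n, B n := hasSum_le hNle hNT hB.hasSum
  have hT' : HasSum (fun p : (ℕ →₀ ℕ) × ℕ => ‖coeff p.1 (Φ p.2)‖ * w p.1) (∑' p, T p) :=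
    (Equiv.prodComm (ℕ →₀ ℕ) ℕ).hasSum_iff.2 hTs.hasSum
  have hg : HasSum (fun a : ℕ →₀ ℕ => ∑' n : ℕ, ‖coeff a (Φ n)‖ * w a) (∑' p, T p) :=
    hT'.prod_fiberwise fun a => (hT'.summable.prod_factor a).hasSum
  have hfg : ∀ a : ℕ →₀ ℕ, ‖coeff a F‖ * w a ≤ ∑' n : ℕ, ‖coeff a (Φ n)‖ * w a := fun a => by
    obtain ⟨s, hs⟩ := hF a
    calc ‖coeff a F‖ * w a ≤ (∑ n ∈ s, ‖coeff a (Φ n)‖) * w a :=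
          mul_le_mul_of_nonneg_right hs (hw a)
      _ = ∑ n ∈ s, ‖coeff a (Φ n)‖ * w a := Finset.sum_mul _ _ _
      _ ≤ ∑' n : ℕ, ‖coeff a (Φ n)‖ * w a :=
          (hT'.summable.prod_factor a).sum_le_tsum _ fun n _ => mul_nonneg (norm_nonneg _) (hw a)
  have hf0 : ∀ a : ℕ →₀ ℕ, 0 ≤ ‖coeff a F‖ * w a := fun a => mul_nonneg (norm_nonneg _) (hw a)
  have hf : Summable fun a : ℕ →₀ ℕ => ‖coeff a F‖ * w a :=
    Summable.of_nonneg_of_le hf0 hfg hg.summable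
  exact ⟨_, (hasSum_le hfg hf.hasSum hg).trans htot, hf.hasSum⟩

/-- `N_ρ(c G^m) ≤ |c| q^m` when `N_ρ(G) ≤ q` (submultiplicativity U0). [folklore] -/
theorem v0_pow_bound {ρ : ℝ} (hρ : 0 ≤ ρ) {G : CSeries} {A q : ℝ} (hAq : A ≤ q)
    (hA : HasSum (fun a : ℕ →₀ ℕ => ‖coeff a G‖ * a.prod fun _ n => ρ ^ n) A) (c : ℂ) (m : ℕ) :
    ∃ D : ℝ, D ≤ ‖c‖ * q ^ m ∧
      HasSum (fun a : ℕ →₀ ℕ => ‖coeff a (c • G ^ m)‖ * a.prod fun _ n => ρ ^ n) D := by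
  have hρ' : ∀ l : ℕ, 0 ≤ (fun _ : ℕ => ρ) l := fun _ => hρ
  have hA0 : 0 ≤ A := hA.nonneg fun a => mul_nonneg (norm_nonneg _) (s3_wprod_nonneg hρ' a)
  obtain ⟨n, hn, hns⟩ := u1_pow_hasSum (w := fun a : ℕ →₀ ℕ => a.prod fun _ n => ρ ^ n)
    (s3_wprod_nonneg hρ') Finsupp.prod_zero_index
    (fun F G A B hF hG => stub_weightedNormMul F G (fun _ => ρ) hρ' A B hF hG) hA m
  exact ⟨‖c‖ * n, mul_le_mul_of_nonneg_left (hn.trans (pow_le_pow_left₀ hA0 hAq m)) (norm_nonneg c),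
    d1_hasSum_norm_smul (ρ := fun _ => ρ) c hns⟩

/-- **Weights of the tails**: `N_ρ(f(G) − Σ_{n<N} f_n Gⁿ) ≤ Σ_m |f_{m+N}| q^{m+N}` when `N_ρ(G) ≤ q`
and `Σ_n |f_n| qⁿ < ∞` (`N = 0`: `N_ρ(f(G)) ≤ Σ_n |f_n| qⁿ`). [folklore] -/
theorem v0_subst_weights {ρ : ℝ} (hρ : 0 ≤ ρ) {G : CSeries} (hG : constantCoeff G = 0) {A q : ℝ}
    (hAq : A ≤ q) (hA : HasSum (fun a : ℕ →₀ ℕ => ‖coeff a G‖ * a.prod fun _ n => ρ ^ n) A)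
    {f : CSeries} {i : ℕ} (hf : ∀ l : ℕ, UsesVar f l → l = i)
    (hs : Summable fun n : ℕ => ‖coeff (single i n) f‖ * q ^ n) (N : ℕ) :
    ∃ E : ℝ, E ≤ (∑' m : ℕ, ‖coeff (single i (m + N)) f‖ * q ^ (m + N)) ∧
      HasSum (fun a : ℕ →₀ ℕ => ‖coeff a (subst (fun l : ℕ => if l = i then G else (X l : CSeries)) f -
        ∑ n ∈ Finset.range N, coeff (single i n) f • G ^ n)‖ * a.prod fun _ n => ρ ^ n) E := by
  refine v0_dominated (w := fun a : ℕ →₀ ℕ => a.prod fun _ n => ρ ^ n)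
    (s3_wprod_nonneg fun _ => hρ) (Φ := fun m => coeff (single i (m + N)) f • G ^ (m + N))
    (B := fun m => ‖coeff (single i (m + N)) f‖ * q ^ (m + N))
    (fun m => v0_pow_bound hρ hAq hA (coeff (single i (m + N)) f) (m + N))
    ((summable_nat_add_iff N).mpr hs) fun a => ⟨Finset.range (degree a + 1), ?_⟩
  rw [v0_coeff_tail hf hG a N]
  simp only [coeff_smul]
  exact norm_sum_le _ _

/-- The summability hypothesis on the axis: `Σ_n |f_n| qⁿ < ∞` for `0 ≤ q ≤ r`. [folklore] -/
theorem v0_summable_axis {f : CSeries} (i : ℕ) {r : ℝ}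
    (hs : Summable fun a : ℕ →₀ ℕ => ‖coeff a f‖ * r ^ degree a) {q : ℝ} (hq0 : 0 ≤ q)
    (hqr : q ≤ r) : Summable fun n : ℕ => ‖coeff (single i n) f‖ * q ^ n := by
  have h1 : Summable fun n : ℕ => ‖coeff (single i n) f‖ * r ^ n :=
    (hs.comp_injective (single_injective i)).congr fun n => by
      simp only [Function.comp_apply, degree_single]
  refine h1.of_nonneg_of_le (fun n => mul_nonneg (norm_nonneg _) (pow_nonneg hq0 n)) fun n => ?_
  exact mul_le_mul_of_nonneg_left (pow_le_pow_left₀ hq0 hqr n) (norm_nonneg _)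

/-! ## The registered auxiliary stub -/

/-- **V0 (auxiliary stub)** — substituting a one-variable series `f = Σ_n f_n zᵢⁿ` into `zᵢ ↦ G`,
`G(0) = 0`: the family `(G; z_l for l ≠ i)` is substitutable; `f(G)` involves only variables of
`G`; `f(G)_a = Σ_{n<M} f_n (Gⁿ)_a` for `M > |a|`; and if `N_ρ(G) ≤ q` (`ρ ≥ 0`) and
`Σ_n |f_n| qⁿ < ∞` then `N_ρ(f(G) − Σ_{n<N} f_n Gⁿ) ≤ Σ_m |f_{m+N}| q^{m+N}` for every `N`.
Registered auxiliary stub of the crux stmt-KontsevichZagierPeriods-18392, line `Sketch`. [folklore] -/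
theorem stub_covSubstAnalyticAux :
    ∀ (i : ℕ) (G : CSeries), MvPowerSeries.constantCoeff G = 0 →
      ∀ (f : CSeries), (∀ l : ℕ, UsesVar f l → l = i) →
        MvPowerSeries.HasSubst (fun l : ℕ => if l = i then G else (X l : CSeries)) ∧
        (∀ l : ℕ,
          UsesVar (MvPowerSeries.subst (fun l : ℕ => if l = i then G else (X l : CSeries)) f) l →
            UsesVar G l) ∧
        (∀ (a : ℕ →₀ ℕ) (M : ℕ), degree a < M →
          MvPowerSeries.coeff a
              (MvPowerSeries.subst (fun l : ℕ => if l = i then G else (X l : CSeries)) f) =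
            ∑ n ∈ Finset.range M,
              MvPowerSeries.coeff (Finsupp.single i n) f * MvPowerSeries.coeff a (G ^ n)) ∧
        (∀ (ρ : ℝ), 0 ≤ ρ → ∀ (A q : ℝ), A ≤ q →
          HasSum (fun a : ℕ →₀ ℕ => ‖MvPowerSeries.coeff a G‖ * a.prod fun _ n => ρ ^ n) A →
          Summable (fun n : ℕ => ‖MvPowerSeries.coeff (Finsupp.single i n) f‖ * q ^ n) →
          ∀ N : ℕ, ∃ E : ℝ,
            E ≤ (∑' m : ℕ, ‖MvPowerSeries.coeff (Finsupp.single i (m + N)) f‖ * q ^ (m + N)) ∧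
            HasSum (fun a : ℕ →₀ ℕ => ‖MvPowerSeries.coeff a
              (MvPowerSeries.subst (fun l : ℕ => if l = i then G else (X l : CSeries)) f -
                ∑ n ∈ Finset.range N, MvPowerSeries.coeff (Finsupp.single i n) f • G ^ n)‖ *
              a.prod fun _ n => ρ ^ n) E) :=
  fun i _ hG _ hf =>
    ⟨v0_hasSubst i hG, fun _ hl => v0_usesVar_subst hf hG hl,
      fun a _ hM => v0_coeff_subst hf hG a hM,
      fun _ hρ _ _ hAq hA hs N => v0_subst_weights hρ hG hAq hA hf hs N⟩

end Summit.KontsevichZagierPeriods.KontsevichZagierPeriods.TypeAGenerationLine
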